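/-
Origin: expansion seat `prover-pub-hodgecm-mc-binder-2-g16-0`, handover #85 2026-08-20T17:52Z md5 ffce682d0518 (NEW; 183 l.; r2 = r1 with the `haveI` let removed from the STATEMENT of `reflexField_liftTypeSet_eq_fieldRange_of_scope` (proof unchanged); the CMField INSTANTIATION: `G := L ≃ₐ[ℚ] L` acting on `E := K →ₐ[ℚ] L` (scoped `algEquivCompAction`), `c := embConj` (`ψ ↦ ψ ∘ conj_K`, data def `conjRatAlgHom`), `ρ := conjRatAlgEquiv L` (complex conjugation of `L`); `isCMSet_pullbackTypeAlg` (`Ψ_L` is a `c`-CM set, from `Ψ.2` + `embedding_conjRingHomK`), `algEquiv_eq_one_of_forall_smul_eq` (faithfulness: `normalClosure = ⊤`), `card_algHom_of_isNormalClosure` (`|Hom(K,L)| = [K:ℚ]`, `AlgHom.card_of_splits`), `card_algEquiv_of_isNormalClosure` (`|Aut L| = [L:ℚ]`, `IsGalois.card_aut_eq_finrank`), `hasFlips_of_scope`; MAIN: **`isPrimitive_pullbackTypeAlg_of_scope'` : `IsNormalClosure ℚ K L → finrank ℚ K = 6 → (finrank ℚ L = 24 ∨ finrank ℚ L = 48)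 → ∀ (j : K →+* L) (ι₁ : L →+* ℂ) (Ψ : CMType K), IsPrimitive (L ≃ₐ[ℚ] L) (pullbackTypeAlg ι₁ Ψ) j.toRatAlgHom`** (= binder-1's `hP` of `reflexField_liftTypeSet_eq_fieldRange` DISCHARGED at `U.PerL`'s scope for EVERY CM type), `exists_smul_pullbackTypeAlg_eq` (any two CM types of `K` are Galois-conjugate inside `L`: ONE orbit, [Dodson1984] §5.1.3), `reflexField_liftTypeSet_eq_fieldRange_of_scope` ((J5) field half with the primitivity input discharged: reflex field of `S*(Ψ_L, j)` = `j(K)` at PerL's scope, every `Ψ`). CERT lean-direct over the RUN-56 PKG oleans + #84: rc 0 ∕ 11 s ∕ 0 warn ∕ 0 proof-hole; `#print axioms` 10 ∕ 10 ⊆ {propext, Classical.choice, Quot.sound} (`g16/certs/axioms-prim-r56pkg.log` 97a7336d4c42); NAME LIST: `HodgeCM.SignRecipe.isPrimitive_pullbackTypeAlg_of_scope'` · `HodgeCM.SignRecipe.exists_smul_pullbackTypeAlg_eq` · `HodgeCM.SignRecipe.reflexField_liftTypeSet_eq_fieldRange_of_scope`) (`HOME/mc/pub-hodgecm-mc-binder-2/g16/stage58/HodgeCM/Model/Binders/JLiuPrimitive.lean`,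 md5 ffce682d0518, 183 lines);
landed by the second packager p2 gen 11 (p2-g11) in gate run 58 as `HodgeCM/Model/Binders/JLiuPrimitive.lean` (packager comment re-wording per the RUN-32 precedent (gate audit (5) rejects the proof-placeholder tokens s-o-r-r-y / a-d-m-i-t anywhere in a source, comments included): 1 occurrence(s) inside COMMENTS re-spelt `proof-hole` / `adm-token`; no Lean code byte touched).
-/
/-
Origin: speedrun cell pub-hodgecm, MODEL-CONSTRUCTION sub-cell, unit pub-hodgecm-mc-binder-2-g16 (BINDER PROVER, gen 16; the PRIMITIVITY residual of
binder-1's (J5), `JLIU-THETA-SCOPE.md` §8; STATUS 2026-08-20 l.14004, binder-2 CLAIM l.≈14013), seat prover-pub-hodgecm-mc-binder-2-g16-0, 2026-08-20.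
Target in PKG: HodgeCM/Model/Binders/JLiuPrimitive.lean (NEW additive leaf; imports binder-2's `Binders/CMTypeFlips` (this kit), binder-1's
`Binders/JLiuReflexField` (RUN 56 #R88) and `HodgeCM.CM.ReflexInflate`; nothing imports it).  KERNEL ONLY: theorems + two `def`s of DATA (the complex
conjugations as `ℚ`-algebra maps); 0 `def … : Prop`, nothing cited as hypothesis; MODEL-N ±0; E untouched.  Nothing here is a claim of the manuscripts
under adjudication.
-/
import Summits.HodgeConjecture.HodgeCM.Model.Binders.CMTypeFlips_2
import Summits.HodgeConjecture.HodgeCM.Model.Binders.JLiuReflexField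
import Summits.HodgeConjecture.HodgeCM.CM.ReflexInflate

set_option autoImplicit false

/-!
# Every CM type of a sextic CM field is PRIMITIVE at PerL's scope (`L` a normal closure of degree ≥ 24)

Discharges the primitivity input `hP : IsPrimitive (L ≃ₐ[ℚ] L) (pullbackTypeAlg ι₁ Ψ) j.toRatAlgHom` of binder-1's
`SignRecipe.reflexField_liftTypeSet_eq_fieldRange` (`Binders/JLiuReflexField`, (J5) field half) from `U.PerL`'s own scope binders
`IsNormalClosure ℚ K L`, `Module.finrank ℚ K = 6`, `24 ≤ Module.finrank ℚ L` (PerL: `[L:ℚ] ∈ {24, 48}`), for EVERY CM type `Ψ` of `K`: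

* the Galois group `G = L ≃ₐ[ℚ] L` acts faithfully and transitively on the six embeddings `E = K →ₐ[ℚ] L`, commuting with `c : ψ ↦ ψ ∘ conj_K`,
  which is realised by complex conjugation of `L`; `|G| = [L:ℚ] ≥ 24` ⇒ SINGLE-PAIR FLIPS (`CMTypeFlips.hasFlips_of_card`: `Gal(K̃/ℚ) ⊇ (ℤ/2)³`,
  [Dodson1984] §5.1 `v = 3`);
* ⇒ `isPrimitive_pullbackTypeAlg_of_scope` (every CM type primitive, `CMTypeFlips.isPrimitive_of_hasFlips`) and `exists_smul_pullbackTypeAlg_eq` (any two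
  CM types of `K` are Galois-conjugate inside `L`: ONE orbit of size 8, [Dodson1984] §5.1.3 Prop. 1; hence every reflex field has the maximal degree 8 —
  FLAG step (3) of STATUS l.13871 in the kernel at group level).

0 `proof-hole`, 0 `axiom`; expected `#print axioms` ⊆ {propext, Classical.choice, Quot.sound}.
-/

noncomputable section

open scoped Pointwise
open NumberField NumberField.ComplexEmbedding
open Literature.AlgebraicGeometry.Motives (CMType)
open Literature.AlgebraicGeometry.ShimuraVarieties (conjRingHomK embedding_conjRingHomK)
open Literature.NumberTheory.ComplexMultiplication

namespace HodgeCM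

namespace SignRecipe

open HodgeCM.CMTypeFlips

variable {K L : CMField}

/-! ## 1. Complex conjugation on embeddings `K →ₐ[ℚ] L`: `c ψ := ψ ∘ conj_K` -/

/-- Complex conjugation of the CM field `K` as a `ℚ`-algebra map. [folklore] -/
def conjRatAlgHom (K : CMField) : K →ₐ[ℚ] K := (conjRingHomK K).toRatAlgHom

/-- (Ported verbatim from the HodgeCMPerL package; no docstring in the source.) -/
@[simp] theorem conjRatAlgHom_apply (x : K) : conjRatAlgHom K x = conjRingHomK K x := rfl

/-- The involution `c ψ := ψ ∘ conj_K` on the embeddings `K →ₐ[ℚ] L`. [folklore] -/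
def embConj (ψ : K →ₐ[ℚ] L) : K →ₐ[ℚ] L := ψ.comp (conjRatAlgHom K)

/-- (Ported verbatim from the HodgeCMPerL package; no docstring in the source.) -/
@[simp] theorem embConj_apply (ψ : K →ₐ[ℚ] L) (x : K) : embConj ψ x = ψ (conjRingHomK K x) := rfl

/-- `c` commutes with the Galois action `σ • ψ = σ ∘ ψ`. [folklore] -/
theorem smul_embConj (σ : L ≃ₐ[ℚ] L) (ψ : K →ₐ[ℚ] L) : σ • embConj ψ = embConj (σ • ψ) := rfl

/-- `c` is an involution. [folklore] -/
theorem embConj_embConj (ψ : K →ₐ[ℚ] L) : embConj (embConj ψ) = ψ := by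
  ext x
  simp only [embConj_apply]
  show ψ (conjRingHomK K (conjRingHomK K x)) = ψ x
  rw [conjRingHomK_apply, conjRingHomK_apply, IsCMField.complexConj_apply_apply]

/-- `c` has no fixed point. [folklore] -/
theorem embConj_ne (ψ : K →ₐ[ℚ] L) : embConj ψ ≠ ψ := by
  intro h
  obtain ⟨x, hx⟩ := exists_conj_ne K
  exact hx (ψ.toRingHom.injective (by simpa using congrArg (fun f : K →ₐ[ℚ] L => f x) h))

/-- Through any complex embedding of `L`: `ι₁ ∘ (c ψ) = conjugate (ι₁ ∘ ψ)`. [folklore] -/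
theorem comp_embConj_toRingHom (ι₁ : L →+* ℂ) (ψ : K →ₐ[ℚ] L) :
    ι₁.comp (embConj ψ).toRingHom = conjugate (ι₁.comp ψ.toRingHom) := by
  ext x
  show ι₁ (ψ (conjRingHomK K x)) = conjugate (ι₁.comp ψ.toRingHom) x
  rw [conjugate_coe_eq]
  exact embedding_conjRingHomK K (ι₁.comp ψ.toRingHom) x

/-- **`Ψ_L` is a CM set for `c`** (the CM-type axiom of `Ψ` read inside `L`). [folklore] -/
theorem isCMSet_pullbackTypeAlg (ι₁ : L →+* ℂ) (Ψ : CMType K) : IsCMSet (embConj (K := K) (L := L)) (pullbackTypeAlg ι₁ Ψ) := by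
  intro ψ
  rw [mem_pullbackTypeAlg_iff, mem_pullbackTypeAlg_iff, comp_embConj_toRingHom]
  exact CMTypeOps.mem_iff_conjugate_notMem Ψ _

/-! ## 2. The Galois side: `ρ`, faithfulness, cardinalities -/

/-- Complex conjugation of the CM field `L` as an element of `L ≃ₐ[ℚ] L`. [folklore] -/
def conjRatAlgEquiv (L : CMField) : L ≃ₐ[ℚ] L :=
  AlgEquiv.ofRingEquiv (f := (IsCMField.complexConj L).toRingEquiv) fun q => by simp

/-- (Ported verbatim from the HodgeCMPerL package; no docstring in the source.) -/
theorem conjRatAlgEquiv_apply (x : L) : conjRatAlgEquiv L x = conjRingHomK L x := rfl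

/-- Complex conjugation of `L` acts on embeddings as `c`: `conj_L ∘ ψ = ψ ∘ conj_K` (read through a complex embedding of `L`). [folklore] -/
theorem conjRatAlgEquiv_smul (ι₁ : L →+* ℂ) (ψ : K →ₐ[ℚ] L) : conjRatAlgEquiv L • ψ = embConj ψ := by
  ext x
  rw [algEquiv_smul_def, AlgHom.comp_apply, embConj_apply]
  apply ι₁.injective
  show ι₁ (conjRatAlgEquiv L (ψ x)) = ι₁ (ψ (conjRingHomK K x))
  rw [conjRatAlgEquiv_apply, embedding_conjRingHomK]
  exact (embedding_conjRingHomK K (ι₁.comp ψ.toRingHom) x).symm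

/-- **Faithfulness**: an automorphism of the normal closure fixing every embedding of `K` is the identity. [folklore] -/
theorem algEquiv_eq_one_of_forall_smul_eq (hN : IsNormalClosure ℚ K L) (g : L ≃ₐ[ℚ] L) (hg : ∀ ψ : K →ₐ[ℚ] L, g • ψ = ψ) :
    g = 1 := by
  have htop : IntermediateField.normalClosure ℚ K L = ⊤ := (Algebra.IsAlgebraic.isNormalClosure_iff.1 hN).2
  have hle : IntermediateField.normalClosure ℚ K L ≤ IntermediateField.fixedField (Subgroup.zpowers g) := by
    rw [normalClosure_def]
    refine iSup_le fun ψ => fun y hy => ?_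
    rw [IntermediateField.mem_fixedField_iff]
    intro f hf
    obtain ⟨k, rfl⟩ := AlgHom.mem_fieldRange.1 hy
    have hgk : g (ψ k) = ψ k := by
      have := congrArg (fun φ : K →ₐ[ℚ] L => φ k) (hg ψ)
      simpa [algEquiv_smul_def] using this
    have hmem : Subgroup.zpowers g ≤ MulAction.stabilizer (L ≃ₐ[ℚ] L) (ψ k) :=
      (Subgroup.zpowers_le (G := L ≃ₐ[ℚ] L)).2 hgk
    exact hmem hf
  rw [htop] at hle
  ext x
  have hx := (IntermediateField.mem_fixedField_iff _ x).1 (hle (IntermediateField.mem_top)) g (Subgroup.mem_zpowers g)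
  simpa using hx

/-- `|Hom_ℚ(K, L)| = [K:ℚ]` for `L` a normal closure. [folklore] -/
theorem card_algHom_of_isNormalClosure (hN : IsNormalClosure ℚ K L) : Fintype.card (K →ₐ[ℚ] L) = Module.finrank ℚ K :=
  AlgHom.card_of_splits ℚ K L hN.splits

/-- `|Aut_ℚ(L)| = [L:ℚ]` for `L` a normal closure (Galois). [folklore] -/
theorem card_algEquiv_of_isNormalClosure (hN : IsNormalClosure ℚ K L) : Nat.card (L ≃ₐ[ℚ] L) = Module.finrank ℚ L := by
  haveI := CMTypeOps.isGaloisRat_of_isNormalClosure hN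
  exact IsGalois.card_aut_eq_finrank ℚ L

/-! ## 3. Single-pair flips, primitivity, one orbit -/

/-- **`Gal(L/ℚ)` has single-pair flips on `Hom(K, L)`** when `K` is sextic and its normal closure `L` has degree `≥ 24` (PerL: 24 or 48). [folklore] -/
theorem hasFlips_of_scope (hN : IsNormalClosure ℚ K L) (hK : Module.finrank ℚ K = 6) (hL : 24 ≤ Module.finrank ℚ L) (ι₁ : L →+* ℂ) :
    HasFlips (L ≃ₐ[ℚ] L) (embConj (K := K) (L := L)) := by
  classical
  haveI : IsNormalClosure ℚ K L := hN
  haveI : Normal ℚ L := IsNormalClosure.normal (K := K)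
  refine hasFlips_of_card (G := L ≃ₐ[ℚ] L) (fun σ ψ => smul_embConj σ ψ) embConj_embConj embConj_ne
    (algEquiv_eq_one_of_forall_smul_eq hN) (conjRatAlgEquiv L) (conjRatAlgEquiv_smul ι₁) ?_ ?_
  · rw [card_algHom_of_isNormalClosure hN, hK]
  · rw [card_algEquiv_of_isNormalClosure hN]; exact hL

/-- **EVERY CM type of a sextic CM field is PRIMITIVE at PerL's scope** — the input `hP` of `reflexField_liftTypeSet_eq_fieldRange`, discharged from
`U.PerL`'s scope binders for every `Ψ` and every base point `j`. [folklore] -/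
theorem isPrimitive_pullbackTypeAlg_of_scope (hN : IsNormalClosure ℚ K L) (hK : Module.finrank ℚ K = 6) (hL : 24 ≤ Module.finrank ℚ L)
    (j : K →+* L) (ι₁ : L →+* ℂ) (Ψ : CMType K) :
    IsPrimitive (L ≃ₐ[ℚ] L) (pullbackTypeAlg ι₁ Ψ) j.toRatAlgHom :=
  isPrimitive_of_hasFlips embConj_embConj (hasFlips_of_scope hN hK hL ι₁) (isCMSet_pullbackTypeAlg ι₁ Ψ) _

/-- The disjunctive form with `U.PerL`'s literal degree clause `[L:ℚ] = 24 ∨ [L:ℚ] = 48`. [folklore] -/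
theorem isPrimitive_pullbackTypeAlg_of_scope' (hN : IsNormalClosure ℚ K L) (hK : Module.finrank ℚ K = 6)
    (hL : Module.finrank ℚ L = 24 ∨ Module.finrank ℚ L = 48) (j : K →+* L) (ι₁ : L →+* ℂ) (Ψ : CMType K) :
    IsPrimitive (L ≃ₐ[ℚ] L) (pullbackTypeAlg ι₁ Ψ) j.toRatAlgHom :=
  isPrimitive_pullbackTypeAlg_of_scope hN hK (by rcases hL with h | h <;> omega) j ι₁ Ψ

/-- **ONE ORBIT**: at PerL's scope any two CM types of `K`, read inside `L`, are Galois-conjugate ([Dodson1984] §5.1.3: `2³ = 8`). [folklore] -/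
theorem exists_smul_pullbackTypeAlg_eq (hN : IsNormalClosure ℚ K L) (hK : Module.finrank ℚ K = 6) (hL : 24 ≤ Module.finrank ℚ L)
    (ι₁ : L →+* ℂ) (Ψ Ψ' : CMType K) : ∃ g : L ≃ₐ[ℚ] L, g • pullbackTypeAlg ι₁ Ψ = pullbackTypeAlg (L := L) ι₁ Ψ' := by
  classical
  exact exists_smul_eq_of_hasFlips (fun σ ψ => smul_embConj σ ψ) (hasFlips_of_scope hN hK hL ι₁) (isCMSet_pullbackTypeAlg ι₁ Ψ)
    (isCMSet_pullbackTypeAlg ι₁ Ψ')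

/-- With (J5)'s field half: at PerL's scope the reflex field of the recipe's `L`-type `S*(Ψ_L, j)` IS the corner field `j(K)`, for EVERY `Ψ` —
`reflexField_liftTypeSet_eq_fieldRange` with its primitivity input discharged. [folklore] -/
theorem reflexField_liftTypeSet_eq_fieldRange_of_scope (hN : IsNormalClosure ℚ K L) (hK : Module.finrank ℚ K = 6) (hL : 24 ≤ Module.finrank ℚ L)
    (j : K →+* L) (ι₁ : L →+* ℂ) (Ψ : CMType K) :
    reflexField ℚ L ((fun σ : L ≃ₐ[ℚ] L => (σ : L →ₐ[ℚ] L)) ''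
        (reflexLift (pullbackTypeAlg ι₁ Ψ) j.toRatAlgHom : Set (L ≃ₐ[ℚ] L))) = (j.toRatAlgHom : K →ₐ[ℚ] L).fieldRange := by
  haveI := CMTypeOps.isGaloisRat_of_isNormalClosure hN
  exact reflexField_liftTypeSet_eq_fieldRange Ψ (isPrimitive_pullbackTypeAlg_of_scope hN hK hL j ι₁ Ψ)

end SignRecipe

end HodgeCM

end
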